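import Literature.Analysis.Matrix.KyFanMaximumPrinciple

/-!
# The Eliashberg member of a `T_c` band: monotonicity in the Coulomb pseudopotential

Screening pipelines for conventional superconductors (the conventional branch of this programme's
material oracle, `pub/hubbard-eph`) report a `T_c` BAND obtained by evaluating two formulas at two
corners of a parameter box: the closed Allen–Dynes formula (whose corner rule is the kernel theorem
`Literature.MathematicalPhysics.QuantumManyBody.allenDynesTc_mem_Icc_of_mem_box`) and the isotropic
linearised Migdal–Eliashberg equations on the Matsubara axis, solved numerically. For the latter the
corner rule rests on ONE structural fact, proved here in the exact form the solvers use: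

on `N` Matsubara frequencies the linearised gap equation is the eigenproblem of the real symmetric
matrix
`K(μ) = S₀ − 2μ · s sᵀ`,
where `S₀ = D (Λ⁻ + Λ⁺) D` carries the phonon kernel `λ(iν)` (a Toeplitz-plus-Hankel matrix
sandwiched by `D = diag(s)`), `s_n = (π T / (ω_n Z_n))^{1/2} > 0`, and `μ = μ*_N` is the Coulomb
pseudopotential at the Matsubara cutoff; `T < T_c` iff the largest eigenvalue `ρ(T, μ)` of `K(μ)`
exceeds `1` [cite: AllenDynes1975, Eqs. (9)–(12) and §III]. Since `μ ↦ K(μ)` DEcreases by the positive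
semidefinite rank-one matrix `2(μ₂ − μ₁) s sᵀ`, EVERY sorted eigenvalue of `K` is antitone in `μ`
(Weyl's monotonicity principle, Horn–Johnson Cor. 4.3.12 = `KyFan.eigenvalues₀_le_of_add_psd` in
this library); hence the super-level set `{T | 1 ≤ ρ(T, μ)}` shrinks as `μ` grows and its supremum —
the Eliashberg `T_c` — is antitone in `μ*`: the band's lower corner is at the larger `μ*`, the upper
corner at the smaller, with no interior search.

Proved here (pure linear algebra + order theory; the physics enters only through the SHAPE of `K`):
* `rankOneDownshift`, `isHermitian_rankOneDownshift` — the family `K(μ) = S₀ − 2μ · s sᵀ` (private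
  plumbing: `xᵀ (c · s sᵀ) x = c (s ⬝ x)²`, the increment `K(μ₁) = K(μ₂) + 2(μ₂ − μ₁) · s sᵀ`);
* `dotProduct_rankOneDownshift_mulVec_antitone` — the quadratic form of `K(μ)` is antitone in `μ`;
* `eigenvalues₀_rankOneDownshift_antitone` — every decreasingly-sorted eigenvalue of `K(μ)` is
  antitone in `μ` (in particular the top one, the solvers' `ρ`);
* `sSup_superlevel_antitone` — if `ρ(·, μ₂) ≤ ρ(·, μ₁)` pointwise then
  `sSup {T | 0 < T ∧ 1 ≤ ρ(T, μ₂)} ≤ sSup {T | 0 < T ∧ 1 ≤ ρ(T, μ₁)}` (threshold form of `T_c`);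
* `one_div_one_div_sub_mono` — the cutoff rescaling of the pseudopotential,
  `μ ↦ μ_N = 1 / (1/μ − L)` with `L = ln(ω_c/ω_ref)`, is monotone on its domain `0 < μ`, `L < 1/μ`
  (so antitonicity in `μ*_N` is antitonicity in the phonon-scale `μ*` under every rescaling convention,
  and is preserved by a Morel–Anderson step to a lower effective cutoff).

Deliberately NOT here: the Eliashberg equations as functionals of `α²F` (the entries of `S₀` and `s`
are plain real parameters), existence/uniqueness of the threshold, monotonicity in `λ` or in the
phonon frequencies (true but via functional derivatives, Bergmann–Rainer 1973 — not needed for the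
`μ*` corners), anisotropic kernels.

## References
* [AllenDynes1975] P. B. Allen, R. C. Dynes, Phys. Rev. B 12 (1975) 905–922 — Eqs. (9)–(12)
  (imaginary-axis linearised Eliashberg equations with `μ*(ω_c)`), §III (dependence of `T_c` on `μ*`).
* [HornJohnson2013] R. A. Horn, C. R. Johnson, *Matrix Analysis*, 2nd ed., CUP 2013 — Cor. 4.3.12
  (monotonicity of eigenvalues under a positive semidefinite perturbation).
-/

noncomputable section

open scoped Matrix

namespace Literature.MathematicalPhysics.QuantumManyBody

open Finset _root_.Matrix Literature.Analysis.Matrix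

variable {ι : Type*} [Fintype ι] [DecidableEq ι]

/-! ### The rank-one Coulomb term -/

omit [DecidableEq ι] in
/-- `(s sᵀ) x = (s ⬝ x) s`: a rank-one matrix acts by projecting on `s`. [folklore] -/
private theorem vecMulVec_self_mulVec (s x : ι → ℝ) : vecMulVec s s *ᵥ x = (s ⬝ᵥ x) • s := by
  ext i
  simp only [mulVec, dotProduct, vecMulVec_apply, Pi.smul_apply, smul_eq_mul, Finset.sum_mul]
  exact Finset.sum_congr rfl fun j _ => by ring

omit [DecidableEq ι] in
/-- The quadratic form of `c · s sᵀ` is `c (s ⬝ x)²` — nonnegative for `c ≥ 0`, which is all that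
Weyl monotonicity needs. [folklore] -/
private theorem dotProduct_smul_vecMulVec_mulVec (c : ℝ) (s x : ι → ℝ) :
    x ⬝ᵥ (c • vecMulVec s s) *ᵥ x = c * (s ⬝ᵥ x) ^ 2 := by
  rw [smul_mulVec, vecMulVec_self_mulVec, dotProduct_smul, dotProduct_smul, smul_eq_mul,
    smul_eq_mul, dotProduct_comm x s]
  ring

omit [Fintype ι] [DecidableEq ι] in
/-- `c · s sᵀ` is symmetric. [folklore] -/
private theorem isHermitian_smul_vecMulVec_self (c : ℝ) (s : ι → ℝ) :
    (c • vecMulVec s s).IsHermitian := by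
  unfold Matrix.IsHermitian
  rw [conjTranspose_eq_transpose_of_trivial, transpose_smul, transpose_vecMulVec]

/-! ### The kernel family `K(μ) = S₀ − 2μ · s sᵀ` -/

/-- **The symmetrised linearised Eliashberg kernel as a function of the Coulomb pseudopotential.**
`rankOneDownshift S₀ s μ = S₀ − 2μ · s sᵀ`: `S₀` is the (symmetric) phonon part on `N` Matsubara
frequencies, `s` the positive symmetrising weights `(πT/(ω_n Z_n))^{1/2}`, `μ = μ*_N` the
pseudopotential at the cutoff; the gap equation at temperature `T` has a solution iff the largest
eigenvalue of this matrix is `≥ 1`. Stated for arbitrary real `S₀`, `s`, `μ`.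
[cite: AllenDynes1975, Eqs. (9)-(12)] -/
def rankOneDownshift (S₀ : Matrix ι ι ℝ) (s : ι → ℝ) (μ : ℝ) : Matrix ι ι ℝ :=
  S₀ - (2 * μ) • vecMulVec s s

omit [Fintype ι] [DecidableEq ι] in
/-- The linearised Eliashberg kernel `K(μ)` is real symmetric when its phonon part `S₀` is (the
symmetrised form of the imaginary-axis gap equation). [cite: AllenDynes1975, Eqs. (9)-(12)] -/
theorem isHermitian_rankOneDownshift {S₀ : Matrix ι ι ℝ} (hS₀ : S₀.IsHermitian) (s : ι → ℝ)
    (μ : ℝ) : (rankOneDownshift S₀ s μ).IsHermitian := by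
  unfold rankOneDownshift
  exact hS₀.sub (isHermitian_smul_vecMulVec_self _ s)

omit [Fintype ι] [DecidableEq ι] in
/-- The increment of the family: `K(μ₁) = K(μ₂) + 2(μ₂ − μ₁) · s sᵀ`. [folklore] -/
private theorem rankOneDownshift_eq_add (S₀ : Matrix ι ι ℝ) (s : ι → ℝ) (μ₁ μ₂ : ℝ) :
    rankOneDownshift S₀ s μ₁ = rankOneDownshift S₀ s μ₂ + (2 * (μ₂ - μ₁)) • vecMulVec s s := by
  unfold rankOneDownshift
  rw [mul_sub, sub_smul, sub_add_sub_cancel]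

omit [DecidableEq ι] in
/-- **The quadratic form of `K(μ)` is antitone in `μ`**: `xᵀ K(μ₂) x ≤ xᵀ K(μ₁) x` for `μ₁ ≤ μ₂`
and every `x` — the quadratic-form (Loewner-order) hypothesis of Weyl's monotonicity principle,
`K(μ₁) − K(μ₂) = 2(μ₂ − μ₁) · s sᵀ ⪰ 0`; no spectral theory needed. [cite: HornJohnson2013, Cor. 4.3.12] -/
theorem dotProduct_rankOneDownshift_mulVec_antitone (S₀ : Matrix ι ι ℝ) (s : ι → ℝ) {μ₁ μ₂ : ℝ}
    (h : μ₁ ≤ μ₂) (x : ι → ℝ) :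
    x ⬝ᵥ rankOneDownshift S₀ s μ₂ *ᵥ x ≤ x ⬝ᵥ rankOneDownshift S₀ s μ₁ *ᵥ x := by
  rw [rankOneDownshift_eq_add S₀ s μ₁ μ₂, add_mulVec, dotProduct_add,
    dotProduct_smul_vecMulVec_mulVec]
  have : 0 ≤ 2 * (μ₂ - μ₁) * (s ⬝ᵥ x) ^ 2 := mul_nonneg (by linarith) (sq_nonneg _)
  linarith

/-- **Every sorted eigenvalue of `K(μ)` is antitone in `μ`** (Weyl monotonicity applied to the
positive semidefinite increment `2(μ₂ − μ₁) · s sᵀ`): for `μ₁ ≤ μ₂` and every index `j`,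
`λ_j↓(K(μ₂)) ≤ λ_j↓(K(μ₁))`. With `j` the top index this is the statement that the linearised
Eliashberg eigenvalue `ρ(T, μ*)` decreases with `μ*` at every temperature.
[cite: HornJohnson2013, Cor. 4.3.12] -/
theorem eigenvalues₀_rankOneDownshift_antitone {S₀ : Matrix ι ι ℝ} (hS₀ : S₀.IsHermitian)
    (s : ι → ℝ) {μ₁ μ₂ : ℝ} (h : μ₁ ≤ μ₂) (j : Fin (Fintype.card ι)) :
    (isHermitian_rankOneDownshift hS₀ s μ₂).eigenvalues₀ j ≤
      (isHermitian_rankOneDownshift hS₀ s μ₁).eigenvalues₀ j := by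
  have hsum : (rankOneDownshift S₀ s μ₂ + (2 * (μ₂ - μ₁)) • vecMulVec s s).IsHermitian := by
    rw [← rankOneDownshift_eq_add]; exact isHermitian_rankOneDownshift hS₀ s μ₁
  have hpsd : ∀ x : ι → ℝ, 0 ≤ x ⬝ᵥ ((2 * (μ₂ - μ₁)) • vecMulVec s s) *ᵥ x := fun x => by
    rw [dotProduct_smul_vecMulVec_mulVec]
    exact mul_nonneg (by linarith) (sq_nonneg _)
  have key := KyFan.eigenvalues₀_le_of_add_psd (isHermitian_rankOneDownshift hS₀ s μ₂) hsum hpsd j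
  have heq : hsum.eigenvalues₀ = (isHermitian_rankOneDownshift hS₀ s μ₁).eigenvalues₀ := by
    congr 1
    exact (rankOneDownshift_eq_add S₀ s μ₁ μ₂).symm
  rw [heq] at key
  exact key

/-- **The top eigenvalue bounds every Rayleigh quotient of `K(μ₂)` by that of `K(μ₁)`'s top
eigenvalue**: for `μ₁ ≤ μ₂` and every `x`, `xᵀ K(μ₂) x ≤ λ_max(K(μ₁)) · xᵀx` — the form in which a
certified enclosure of ONE eigenvalue at the smaller `μ*` controls the solver at the larger.
[cite: HornJohnson2013, Thm. 4.2.2 (c)] -/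
theorem dotProduct_rankOneDownshift_mulVec_le_eigenvalues₀_max {S₀ : Matrix ι ι ℝ}
    (hS₀ : S₀.IsHermitian) (s : ι → ℝ) {μ₁ μ₂ : ℝ} (h : μ₁ ≤ μ₂) (hn : 1 ≤ Fintype.card ι)
    (x : ι → ℝ) :
    x ⬝ᵥ rankOneDownshift S₀ s μ₂ *ᵥ x ≤
      (isHermitian_rankOneDownshift hS₀ s μ₁).eigenvalues₀ (Fin.castLE hn 0) * (x ⬝ᵥ x) :=
  (dotProduct_rankOneDownshift_mulVec_antitone S₀ s h x).trans
    (KyFan.dotProduct_mulVec_le_eigenvalues₀_max_mul (isHermitian_rankOneDownshift hS₀ s μ₁) hn x)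

/-! ### From the eigenvalue to the threshold temperature -/

/-- **Threshold form of `T_c`.** If a quantity `ρ μ T` is pointwise smaller at `μ₂` than at `μ₁`
(as the top Eliashberg eigenvalue is, by `eigenvalues₀_rankOneDownshift_antitone`, at every `T`),
then the supremum of the positive temperatures at which it reaches `1` — the linearised-equation
`T_c` — is smaller at `μ₂`, provided the super-level set at `μ₁` is bounded above. (`sSup ∅ = 0`
in `ℝ` covers "no superconductivity at `μ₂`".) This is the printed statement «`T_c` is a
monotonically decreasing function of `μ*`» in threshold form. [cite: AllenDynes1975, §III] -/
theorem sSup_superlevel_antitone {ρ : ℝ → ℝ → ℝ} {μ₁ μ₂ : ℝ}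
    (hρ : ∀ T, ρ μ₂ T ≤ ρ μ₁ T) (hbdd : BddAbove {T : ℝ | 0 < T ∧ 1 ≤ ρ μ₁ T}) :
    sSup {T : ℝ | 0 < T ∧ 1 ≤ ρ μ₂ T} ≤ sSup {T : ℝ | 0 < T ∧ 1 ≤ ρ μ₁ T} := by
  have hsub : {T : ℝ | 0 < T ∧ 1 ≤ ρ μ₂ T} ⊆ {T : ℝ | 0 < T ∧ 1 ≤ ρ μ₁ T} :=
    fun T ⟨hT, h1⟩ => ⟨hT, h1.trans (hρ T)⟩
  by_cases hne : ({T : ℝ | 0 < T ∧ 1 ≤ ρ μ₂ T} : Set ℝ).Nonempty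
  · exact csSup_le_csSup hbdd hne hsub
  · rw [Set.not_nonempty_iff_eq_empty] at hne
    rw [hne, Real.sSup_empty]
    exact Real.sSup_nonneg fun T hT => hT.1.le

/-- **The super-level set only shrinks**: `{T | 0 < T ∧ 1 ≤ ρ μ₂ T} ⊆ {T | 0 < T ∧ 1 ≤ ρ μ₁ T}`
whenever `ρ μ₂ ≤ ρ μ₁` pointwise — the set-level statement behind the corner rule (no boundedness
needed). [cite: AllenDynes1975, §III] -/
theorem superlevel_subset_of_le {ρ : ℝ → ℝ → ℝ} {μ₁ μ₂ : ℝ} (hρ : ∀ T, ρ μ₂ T ≤ ρ μ₁ T) :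
    {T : ℝ | 0 < T ∧ 1 ≤ ρ μ₂ T} ⊆ {T : ℝ | 0 < T ∧ 1 ≤ ρ μ₁ T} :=
  fun T ⟨hT, h1⟩ => ⟨hT, h1.trans (hρ T)⟩

/-! ### The cutoff rescaling of the pseudopotential is monotone -/

/-- **Rescaling conventions preserve the order of `μ*`.** The Matsubara-cutoff pseudopotential
`μ_N = 1/(1/μ − L)` (`L = ln(ω_c/ω_ref)`: `ω_ref = ω_max` or `ω_log` for the phonon-scale readings,
`L = 0` for the cutoff reading; a Morel–Anderson step to a lower effective cutoff is the same map
with `L ≤ 0`) is monotone in `μ` on its domain `0 < μ`, `L < 1/μ`. Hence `T_c` antitone in `μ_N`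
is `T_c` antitone in the phonon-scale `μ*` under every convention. [cite: AllenDynes1975, §III] -/
theorem one_div_one_div_sub_mono {L μ₁ μ₂ : ℝ} (h₁ : 0 < μ₁) (h : μ₁ ≤ μ₂) (hL : L < 1 / μ₂) :
    1 / (1 / μ₁ - L) ≤ 1 / (1 / μ₂ - L) := by
  have h₂ : 0 < μ₂ := lt_of_lt_of_le h₁ h
  have hinv : 1 / μ₂ ≤ 1 / μ₁ := one_div_le_one_div_of_le h₁ h
  have hd₂ : 0 < 1 / μ₂ - L := by linarith
  exact one_div_le_one_div_of_le hd₂ (by linarith)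

/-- The rescaled pseudopotential is positive whenever `L < 1/μ` (so it is an admissible `μ` for the
kernel family). [cite: AllenDynes1975, §III] -/
theorem one_div_one_div_sub_pos {L μ : ℝ} (hL : L < 1 / μ) : 0 < 1 / (1 / μ - L) :=
  one_div_pos.mpr (by linarith)

end Literature.MathematicalPhysics.QuantumManyBody

end
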